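/-
Copyright (c) 2026 the pub-hodgecm-mathlib formalisation cell (harness21).  Prover seat hodgecm-mathlib-LH5-p04 (g5): LH4-plan (g6) WORDS #117∕#120 «CENSUS-M1 row #14 — the
LIFT-rider twin on the trace frame», part I (census `F0/P3c/LH5/LH5-p04/g5/row14/CENSUS-row14-rider-trace.v1.md` 4af33787b5f46e68); 2026-09-02.
-/
import Literature.NumberTheory.Rogawski1990.TwoDeepRepresentativesTypeOne                 -- ★ the original rider (F0P3b-p01 (g12)): `exists_conj_mem_localIntegralLevel_of_literal` (2-free transport) REUSED BY NAME + its ★ imports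
import Literature.NumberTheory.Rogawski1990.FlickerRepresentativesTraceFrame               -- ★ p851833 (LH4-p01 (g6)): `exists_four_matched_trace_representatives` (brings ★ `FlickerTraceFramePermutation`, ★ p851771, ★ p851724)
import Literature.NumberTheory.Rogawski1990.FlickerScalarsTraceCM                          -- ★ p851783 (LH4-p01 (g6)): `exists_traceFrame_scalars_of_nonsplit'` (`b π π′ ε`, NO `|2|_w = 1`)
import Literature.NumberTheory.Rogawski1990.TwoDeepRepresentativesTypeOneOrgansTrace       -- ★ p851820 (this seat): `valued_traceTorusEltPi_sub_one_le`, `map_evalRingHom_traceTorusElt{,Pi}`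
import HarnessLib

/-!
# LIFT rider (H2D), type (1), ½-FREE — part I: the rider AT one matched element, at EVERY residue characteristic
# (Rogawski 1990 Prop. 4.9.1; Flicker 1998 §6; Jacobowitz 1962 §7)

Topic `NumberTheory/Rogawski1990`; namespace `Literature.NumberTheory.Rogawski1990`.  THEOREMS ONLY (no definition, no instance, no notation, no named fact, no `sorry`);
count-neutral; kernel lane `--supports stmt-HodgeConjecture-24833`.  Cell `pub/hodgecm-mathlib` (D-0151), crux H413 = `stmt-HodgeConjecture-24833`, half A line LH4 (dyadic
pay-down; (D-UNR) PRINT by ruling D74′), LEAD T13-42 (4), LH4-plan (g6) WORDS #117∕#120: CENSUS-M1 `bf2b9cff` row #14 = the CONSUMER re-base of the M1 trace-frame literal layer.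
THE TWIN of ★ `TwoDeepRepresentativesTypeOne.twoDeepRep_typeOne_at` (F0P3b-p01 (g12)) with its one non-structural hypothesis `h2 : IsUnit (2 : 𝒪_w)` DELETED and nothing else moved
(binders otherwise token for token, conclusion verbatim): **`twoDeepRep_typeOne_at_trace`**; the neighbourhood head is part II (`TwoDeepRepresentativesTypeOneTraceHead`).
WHERE `h2` WAS READ and what replaces it: Flicker's scalars `e = ½`, `x x̄ = 2`, `y ȳ = −2` ↦ the trace scalars `b + σb = 1` (`|b_w| = 1`), `π` `σ`-fixed non-norm, `ππ′ = 1`,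
`|π_w| = |ϖ_w|`, `σε·ε = −1` (★ `exists_traceFrame_scalars_of_nonsplit'`); Flicker's four matched representatives ↦ ★ `exists_four_matched_trace_representatives` (literals
`t₁^{(b)}(a,u,d)`, `t_π^{(b)}(a,u,d)`, `t_π^{(b)}(a,d,u)`, `t_π^{(b)}(u,a,d)` over `Q_b`); the signs `κ = (+,+,−,−)` ↦ ★ `finKappaAt_trace_representatives_eq` (frame Grams by ★
`g{Three,Four}Trace_mul_traceFrame` + ★ `twistGram_traceFrame{Three,Four}`); the depth of the literals at `D = |ϖ_w|²` ↦ ★ (T6) `valued_traceTorusElt_sub_one_le` (`τ₁`) and ★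
`valued_traceTorusEltPi_sub_one_le` (`τ₂ τ₃ τ₄`, arguments permuted) at `σ := σ_w = galAdicCompletionMap hw`, `b := b_w` — NO `|½| ≤ 1`.  §0 extracts the original's inline
«deep eigenvalues» computation as two generic lemmas (the 400-line rule); everything else is VERBATIM from the original (uniformizer, integrality, ★ `exists_flicker_exponents_split`,
eigenframe, ★ support organ `mk_eq_or_of_finExplicitDelta_out_ne_zero`, ★ transport `exists_conj_mem_localIntegralLevel_of_literal` cited by name, conclusion); the original's
unused `1 ≤ N₁, N₂, N` lines are dropped.  HONEST READER LABEL: count-neutral; pays no organ, opens no road ((D-UNR) PRINT by D74′ untouched) — it removes `|2|_w = 1` from the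
type-(1) LIFT rider; HC_CM is proved only modulo the 7 printed citations (2 remaining named inputs: hLiu418 = stmt-HodgeConjecture-24832, h413 = stmt-HodgeConjecture-24833) until rung 0 closes.

## References
* [Rogawski1990] J. D. Rogawski, *Automorphic Representations of Unitary Groups in Three Variables* (1990): §4.9 Prop. 4.9.1 (a) p. 55; §4.3 (4.3.1)–(4.3.2) p. 43; §3.1 p. 19.
* [Flicker1998UnitaryFL] Y. Z. Flicker, *Elementary proof of the fundamental lemma for a unitary group*, Canad. J. Math. 50 (1998): Prop. 3 p. 78; §6 pp. 95–97.
* [Jacobowitz1962] R. Jacobowitz, *Hermitian forms over local fields*, Amer. J. Math. 84 (1962): §7 Thm. 7.1.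
-/

set_option autoImplicit false

noncomputable section

open NumberField IsDedekindDomain MeasureTheory Measure Topology Filter Matrix Polynomial
open Literature.NumberTheory.Rogawski1990 Literature.NumberTheory.Automorphic Literature.NumberTheory.GaloisRepresentations
open Literature.NumberTheory.Automorphic.UnitaryGroup Literature.NumberTheory.Automorphic.IntegralReduction
open scoped Matrix MatrixGroups ValuativeRel

namespace Literature.NumberTheory.Rogawski1990

/-! ## §0 Deep eigenvalues of a residually unipotent `2 × 2` characteristic polynomial (any valued field) -/

section Deep

variable {K : Type*} [Field K] {Γ₀ : Type*} [LinearOrderedCommGroupWithZero Γ₀] [Valued K Γ₀]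

/-- **A root of `z² − Tz + D` with `|T − 2| < 1`, `|D − 1| < 1` is `≡ 1`**: first `|z| ≤ 1` (domination by the monic term; `T, D` are integral), then `(z − 1)² = (T − 2)z − (D − 1)`
has valuation `< 1`.  The inline deepness step of ★ `twoDeepRep_typeOne_at`, extracted (2-free). [cite: Rogawski1990, §3.1 p. 19; §4.9 Prop. 4.9.1 (a) p. 55] -/
theorem valued_sub_one_lt_one_of_quadratic {T D z : K} (htr : Valued.v (T - 2) < 1) (hdet : Valued.v (D - 1) < 1) (hz : z ^ 2 - T * z + D = 0) :
    Valued.v (z - 1) < 1 := by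
  have hv2 : Valued.v (2 : K) ≤ 1 := by
    rw [← one_add_one_eq_two]; exact (Valuation.map_add _ _ _).trans (max_le (le_of_eq (map_one _)) (le_of_eq (map_one _)))
  have htr1 : Valued.v T ≤ 1 := by
    have h := Valuation.map_add Valued.v (T - 2) 2
    rw [sub_add_cancel] at h
    exact h.trans (max_le htr.le hv2)
  have hdet1 : Valued.v D ≤ 1 := by
    have h := Valuation.map_add Valued.v (D - 1) 1
    rw [sub_add_cancel] at h
    exact h.trans (max_le hdet.le (le_of_eq (map_one _)))
  -- `|z| ≤ 1`: a root of a monic integral quadratic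
  have hz1 : Valued.v z ≤ 1 := by
    by_contra hlt
    push Not at hlt
    have hzz : Valued.v (z ^ 2) = Valued.v z * Valued.v z := by rw [pow_two, map_mul]
    have h1 : Valued.v (T * z) < Valued.v (z ^ 2) := by
      rw [hzz, map_mul]
      exact mul_lt_mul_of_lt_of_le_of_nonneg_of_pos (lt_of_le_of_lt htr1 hlt) le_rfl zero_le (lt_trans zero_lt_one hlt) |>.trans_le le_rfl
    have h2 : Valued.v D < Valued.v (z ^ 2) := by
      rw [hzz]
      calc Valued.v D ≤ 1 := hdet1
        _ = 1 * 1 := (mul_one 1).symm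
        _ < Valued.v z * Valued.v z := mul_lt_mul'' hlt hlt zero_le zero_le
    have h3 : Valued.v (z ^ 2 - T * z + D) = Valued.v (z ^ 2) := by
      rw [Valuation.map_add_eq_of_lt_left _ (by rw [Valuation.map_sub_eq_of_lt_left _ h1]; exact h2), Valuation.map_sub_eq_of_lt_left _ h1]
    rw [hz, map_zero] at h3
    exact (pow_ne_zero 2 (ne_of_gt (lt_trans zero_lt_one hlt)) : Valued.v z ^ 2 ≠ 0) (by rw [← map_pow]; exact h3.symm)
  have hsq : (z - 1) ^ 2 = (T - 2) * z - (D - 1) := by linear_combination hz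
  have hlt : Valued.v ((z - 1) ^ 2) < 1 := by
    rw [hsq]
    refine lt_of_le_of_lt (Valuation.map_sub _ _ _) (max_lt ?_ hdet)
    rw [map_mul]
    exact mul_lt_one_of_nonneg_of_lt_one_left zero_le htr hz1
  by_contra hge
  push Not at hge
  rw [map_pow] at hlt
  exact absurd hlt (not_lt.2 (one_le_pow₀ hge))

/-- **Quantitative form: `|T − 2|, |D − 1| < |ϖ|⁶` (`|ϖ| ≤ 1`) forces `|z − 1| < |ϖ|³`** for every root of `z² − Tz + D` (`(z − 1)² = (T − 2)z − (D − 1)`, `|z| ≤ 1`) — the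
«3-DEEP eigen-data» of ★ `twoDeepRep_typeOne_at`, extracted (2-free). [cite: Rogawski1990, §4.9 Prop. 4.9.1 (a) p. 55] [cite: Flicker1998UnitaryFL, §6 p. 97] -/
theorem valued_sub_one_lt_pow_three_of_quadratic {T D z ϖ : K} (hϖ : Valued.v ϖ ≤ 1)
    (htr : Valued.v (T - 2) < Valued.v (ϖ ^ 6)) (hdet : Valued.v (D - 1) < Valued.v (ϖ ^ 6)) (hz : z ^ 2 - T * z + D = 0) :
    Valued.v (z - 1) < Valued.v (ϖ ^ 3) := by
  have hϖ6 : Valued.v (ϖ ^ 6) ≤ 1 := by rw [map_pow]; exact pow_le_one₀ zero_le hϖ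
  have hz1' : Valued.v (z - 1) < 1 := valued_sub_one_lt_one_of_quadratic (lt_of_lt_of_le htr hϖ6) (lt_of_lt_of_le hdet hϖ6) hz
  have hzle : Valued.v z ≤ 1 := by
    have h := Valuation.map_add Valued.v (z - 1) 1
    rw [sub_add_cancel] at h
    exact h.trans (max_le hz1'.le (le_of_eq (map_one _)))
  have hsq : (z - 1) ^ 2 = (T - 2) * z - (D - 1) := by linear_combination hz
  have hlt : Valued.v ((z - 1) ^ 2) < Valued.v (ϖ ^ 6) := by
    rw [hsq]
    refine lt_of_le_of_lt (Valuation.map_sub _ _ _) (max_lt ?_ hdet)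
    rw [map_mul]
    exact lt_of_le_of_lt (mul_le_of_le_one_right zero_le hzle) htr
  rw [map_pow, show ϖ ^ 6 = (ϖ ^ 3) ^ 2 by ring, map_pow (Valued.v) (ϖ ^ 3) 2] at hlt
  exact lt_of_pow_lt_pow_left₀ 2 zero_le hlt

end Deep

/-! ## §1 The rider at one matched element, ½-free -/

set_option maxHeartbeats 800000 in
open scoped Classical in
/-- **The rider AT ONE MATCHED ELEMENT, ½-FREE** (`γ_H ∈ K_H`, 3-deep eigen-data, `G`-regular, type (1), not of Levi type; NO `|2|_w = 1`): every `Δ‴`-support class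
meeting `K` has a `K`-representative `≡ 1 (mod ϖ_v²)` at `w` — twin of ★ `twoDeepRep_typeOne_at` with `h2` DELETED, on the trace frame (scalars ★ `exists_traceFrame_scalars_of_nonsplit'`,
representatives ★ `exists_four_matched_trace_representatives`, signs ★ `finKappaAt_trace_representatives_eq`, depth ★ (T6) `valued_traceTorusElt_sub_one_le` ∕ ★ `valued_traceTorusEltPi_sub_one_le`). [cite: Rogawski1990, §4.9 Prop. 4.9.1 (a) p. 55] [cite: Flicker1998UnitaryFL, §6 p. 97] [cite: Jacobowitz1962, §7 Thm. 7.1] -/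
theorem twoDeepRep_typeOne_at_trace
    (L : Type) [Field L] [NumberField L] [IsCMField L] (H' : Matrix (Fin 3) (Fin 3) L) (μ : HeckeCharacter L)
    {v : HeightOneSpectrum (𝓞 ↥(maximalRealSubfield L))}
    (hH' : (H'.map (cmConjRingHom L)).transpose = H') (w : PlacesOver L v)
    (hw : IsCMField.complexConj L • w.1 = w.1) (hv : Algebra.IsUnramifiedIn (𝓞 L) v.asIdeal)
    (hH'w : IsUnit (placeForm H' w.1)) (hH'i : hH'w.unit ∈ glInt 3 (w.1.adicCompletion L))
    (γH : ((cmDatum L 2 (Matrix.of fun i j : Fin 2 => if i.val + j.val + 1 = 2 then (1 : L) else 0)).Local v ×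
      (cmDatum L 1 (Matrix.of fun i j : Fin 1 => if i.val + j.val + 1 = 1 then (1 : L) else 0)).Local v))
    (hγK : γH ∈ ((cmLocalIntegralLevel L 2 (Matrix.of fun i j : Fin 2 => if i.val + j.val + 1 = 2 then (1 : L) else 0) v).prod
      (cmLocalIntegralLevel L 1 (Matrix.of fun i j : Fin 1 => if i.val + j.val + 1 = 1 then (1 : L) else 0) v)))
    (htr : Valued.v (((γH.1.val : GL (Fin 2) (UnitaryGroup.LocalRing L v)).val.map (Pi.evalRingHom (fun w' : PlacesOver L v => w'.1.adicCompletion L) w)).trace - 2) <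
      Valued.v ((toPlace v w (HeckeCharacter.uniformizer ↥(maximalRealSubfield L) v : v.adicCompletion ↥(maximalRealSubfield L))) ^ 6))
    (hdet : Valued.v (((γH.1.val : GL (Fin 2) (UnitaryGroup.LocalRing L v)).val.map (Pi.evalRingHom (fun w' : PlacesOver L v => w'.1.adicCompletion L) w)).det - 1) <
      Valued.v ((toPlace v w (HeckeCharacter.uniformizer ↥(maximalRealSubfield L) v : v.adicCompletion ↥(maximalRealSubfield L))) ^ 6))
    (hub : Valued.v (finGammaTwo L v γH w - 1) < Valued.v ((toPlace v w (HeckeCharacter.uniformizer ↥(maximalRealSubfield L) v : v.adicCompletion ↥(maximalRealSubfield L))) ^ 3))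
    (hreg : IsLocalGRegular L v γH)
    (hsplit : ∃ x : w.1.adicCompletion L, (((γH.1.val : GL (Fin 2) (UnitaryGroup.LocalRing L v)).val.map
          (Pi.evalRingHom (fun w' : PlacesOver L v => w'.1.adicCompletion L) w)).charpoly).IsRoot x)
    (hlev : ¬ (∃ (y : ((cmDatum L 2 (Matrix.of fun i j : Fin 2 => if i.val + j.val + 1 = 2 then (1 : L) else 0)).Local v ×
      (cmDatum L 1 (Matrix.of fun i j : Fin 1 => if i.val + j.val + 1 = 1 then (1 : L) else 0)).Local v)) (d' : Fin 2 → (UnitaryGroup.LocalRing L v)ˣ),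
          glDiagonal 2 (UnitaryGroup.LocalRing L v) d' = ((y * γH * y⁻¹).1.val : GL (Fin 2) (UnitaryGroup.LocalRing L v)))) :
      (∀ cG : ConjClasses ((cmDatum L 3 H').Local v),
          ((finExplicitCollection L H' μ (finExplicitDelta_conj_left_all L H' μ) (finExplicitDelta_conj_right_all L H' μ)) v).Δ γH (Quotient.out cG) ≠ 0 →
          (∃ z ∈ cmLocalIntegralLevel L 3 H' v, ConjClasses.mk z = cG) →
          ∃ γ₀ : ((cmDatum L 3 H').Local v), ConjClasses.mk γ₀ = cG ∧ γ₀ ∈ cmLocalIntegralLevel L 3 H' v ∧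
            (∀ a b, Valued.v (((toPlace v w (HeckeCharacter.uniformizer ↥(maximalRealSubfield L) v : v.adicCompletion ↥(maximalRealSubfield L))) ^ 2)⁻¹ *
        ((((localNonsplitEquiv (IsCMField.complexConj L) H' (IsCMField.complexConj_ne_one L) w hw (γ₀) :
            ↥(unitaryGroupOfForm (galAdicCompletionMap (L := L) (IsCMField.complexConj L) hw) (placeForm H' w.1))) : GL (Fin 3) (w.1.adicCompletion L)) :
              Matrix (Fin 3) (Fin 3) (w.1.adicCompletion L)) a b - (1 : Matrix (Fin 3) (Fin 3) (w.1.adicCompletion L)) a b)) ≤ 1)) := by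
  classical
  haveI := Literature.NumberTheory.Automorphic.isAdicComplete_maximalIdeal_valuedInteger_adicCompletion L w.1
  have hiso := ValuativeRel.isEquiv (ValuativeRel.valuation (w.1.adicCompletion L))
    (Valued.v : Valuation (w.1.adicCompletion L) (WithZero (Multiplicative ℤ)))
  have hc1 : IsCMField.complexConj L ≠ 1 := IsCMField.complexConj_ne_one L
  -- `H′` hermitian in the `IsCMField.complexConj` spelling, and invertible (its image at `w` is)
  have hH'c : (H'.map (IsCMField.complexConj L))ᵀ = H' := by
    have e1 : H'.map (cmConjRingHom L) = H'.map (IsCMField.complexConj L) := by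
      ext i j; simp [Matrix.map_apply, cmConjRingHom_apply]
    rw [← e1]; exact hH'
  have hH'u : IsUnit H' := by
    rw [Matrix.isUnit_iff_isUnit_det]
    have h := (Matrix.isUnit_iff_isUnit_det _).1 hH'w
    change IsUnit (H'.map (algebraMap L (w.1.adicCompletion L))).det at h
    rw [← RingHom.mapMatrix_apply, ← RingHom.map_det, isUnit_iff_ne_zero, _root_.map_ne_zero] at h
    exact isUnit_iff_ne_zero.2 h
  -- the uniformizer `ϖ_w = ι_w(ϖ_v)` and the weaker depth bounds used by the frames
  set ϖw : w.1.adicCompletion L := (toPlace v w (HeckeCharacter.uniformizer ↥(maximalRealSubfield L) v : v.adicCompletion ↥(maximalRealSubfield L))) with hϖw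
  have hϖ1 : Valued.v ϖw = WithZero.exp (-1 : ℤ) :=
    Literature.NumberTheory.Automorphic.Liu2021.LemD1IndexedNonVacuityInertCofinite.valued_toPlace_uniformizer_of_isUnramifiedIn L v hv w
  have hϖlt : Valued.v ϖw < 1 := by rw [hϖ1, ← WithZero.exp_zero]; exact WithZero.exp_lt_exp.2 (by norm_num)
  have hϖ0 : Valued.v ϖw ≠ 0 := by rw [hϖ1]; exact WithZero.exp_ne_zero
  have hϖpow : ∀ m : ℕ, Valued.v (ϖw ^ m) ≤ 1 := fun m => by rw [map_pow]; exact pow_le_one₀ zero_le hϖlt.le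
  have hlt1 : ∀ {s : w.1.adicCompletion L} {m : ℕ}, Valued.v s < Valued.v (ϖw ^ m) → Valued.v s < 1 := fun {s} {m} hs => lt_of_lt_of_le hs (hϖpow m)
  have htr1' : Valued.v (((γH.1.val : GL (Fin 2) (UnitaryGroup.LocalRing L v)).val.map (Pi.evalRingHom (fun w' : PlacesOver L v => w'.1.adicCompletion L) w)).trace - 2) < 1 :=
    hlt1 htr
  have hdet1' : Valued.v (((γH.1.val : GL (Fin 2) (UnitaryGroup.LocalRing L v)).val.map (Pi.evalRingHom (fun w' : PlacesOver L v => w'.1.adicCompletion L) w)).det - 1) < 1 :=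
    hlt1 hdet
  have hub1 : Valued.v (finGammaTwo L v γH w - 1) < 1 := hlt1 hub
  have hvs : Subsingleton (PlacesOver L v) :=
    PlacesOver.subsingleton_of_smul_eq (IsCMField.complexConj L) (IsCMField.complexConj_ne_one L) w hw
  -- §2 INTEGRALITY of `χ_{ι(γ_H),w}` (from `γ_H ∈ K_H`) and the split eigen-data `α ≠ γ`, `N₁, N₂, N`
  have hιK := (endoEmbLocal_mem_cmLocalIntegralLevel_iff L v γH).2 hγK
  have hKw := ((mem_localIntegralLevel_iff (IsCMField.complexConj L) 3 _ v (endoEmbLocal L v γH)).1 hιK) w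
  have hmat : ((localGLPiEquiv L 3 v ((endoEmbLocal L v γH).val : GL (Fin 3) (UnitaryGroup.LocalRing L v)) w : GL (Fin 3) (w.1.adicCompletion L)) :
      Matrix (Fin 3) (Fin 3) (w.1.adicCompletion L)) =
      ((endoEmbLocal L v γH).val : GL (Fin 3) (UnitaryGroup.LocalRing L v)).val.map (Pi.evalRingHom (fun w' : PlacesOver L v => w'.1.adicCompletion L) w) := by
    ext i j; rw [localGLPiEquiv_apply_apply, Matrix.map_apply]; rfl
  have hint : ∀ i : ℕ, ((((endoEmbLocal L v γH).val : GL (Fin 3) (LocalRing L v)).val.map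
      (Pi.evalRingHom (fun w' : PlacesOver L v => w'.1.adicCompletion L) w)).charpoly.coeff i) ∈ 𝒪[w.1.adicCompletion L] := by
    intro i
    have h := coeff_charpoly_mem_integer_of_mem_glInt hKw i
    rwa [hmat] at h
  have hintV : ∀ i : ℕ, ((((endoEmbLocal L v γH).val : GL (Fin 3) (UnitaryGroup.LocalRing L v)).val.map
      (Pi.evalRingHom (fun w' : PlacesOver L v => w'.1.adicCompletion L) w)).charpoly.coeff i) ∈ Valued.integer (w.1.adicCompletion L) :=
    fun i => (Valuation.mem_integer_iff _ _).2 ((hiso.le_one_iff_le_one).1 ((Valuation.mem_integer_iff _ _).1 (hint i)))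
  obtain ⟨α, γ, N₁, N₂, N, hα, hγ, hαγ, hN₁, hN₂, hN, htri⟩ := exists_flicker_exponents_split L v w hw hreg hintV hsplit
  -- §3 DEEPNESS: `α, γ ≡ 1 (mod 𝔪_w)` and 3-DEEP (from `|tr g_w − 2|, |det g_w − 1| < |ϖ|⁶`; §0 below∕above)
  have hcm : ((((γH.1.val : GL (Fin 2) (LocalRing L v)) : Matrix (Fin 2) (Fin 2) (LocalRing L v)).charpoly).map
      (Pi.evalRingHom (fun w' : PlacesOver L v => w'.1.adicCompletion L) w)) =
      X ^ 2 - C ((γH.1.val : GL (Fin 2) (UnitaryGroup.LocalRing L v)).val.map (Pi.evalRingHom (fun w' : PlacesOver L v => w'.1.adicCompletion L) w)).trace * X +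
        C ((γH.1.val : GL (Fin 2) (UnitaryGroup.LocalRing L v)).val.map (Pi.evalRingHom (fun w' : PlacesOver L v => w'.1.adicCompletion L) w)).det := by
    rw [← Matrix.charpoly_map, Matrix.charpoly_fin_two]
  have hz0 : ∀ z : w.1.adicCompletion L, ((((γH.1.val : GL (Fin 2) (LocalRing L v)) : Matrix (Fin 2) (Fin 2) (LocalRing L v)).charpoly).map
      (Pi.evalRingHom (fun w' : PlacesOver L v => w'.1.adicCompletion L) w)).IsRoot z →
      z ^ 2 - ((γH.1.val : GL (Fin 2) (UnitaryGroup.LocalRing L v)).val.map (Pi.evalRingHom (fun w' : PlacesOver L v => w'.1.adicCompletion L) w)).trace * z + ((γH.1.val : GL (Fin 2) (UnitaryGroup.LocalRing L v)).val.map (Pi.evalRingHom (fun w' : PlacesOver L v => w'.1.adicCompletion L) w)).det = 0 := by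
    intro z hz
    rw [hcm] at hz
    simpa only [Polynomial.IsRoot, eval_add, eval_sub, eval_mul, eval_pow, eval_X, eval_C] using hz
  have hα1 : Valued.v (α - 1) < 1 := valued_sub_one_lt_one_of_quadratic htr1' hdet1' (hz0 α hα)
  have hγ1 : Valued.v (γ - 1) < 1 := valued_sub_one_lt_one_of_quadratic htr1' hdet1' (hz0 γ hγ)
  have hα3 : Valued.v (α - 1) < Valued.v (ϖw ^ 3) := valued_sub_one_lt_pow_three_of_quadratic hϖlt.le htr hdet (hz0 α hα)
  have hγ3 : Valued.v (γ - 1) < Valued.v (ϖw ^ 3) := valued_sub_one_lt_pow_three_of_quadratic hϖlt.le htr hdet (hz0 γ hγ)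
  -- §4 THE TRACE SCALARS `b π π′ ε` (★ p851783, NO `|2|_w = 1`), AN EIGENFRAME OF `g`, THE FOUR MATCHED TRACE REPRESENTATIVES (★ (P3c))
  obtain ⟨b, π, π', ε, hb, hvb, hσπ, hππ, hπN, hvπ, hε⟩ := exists_traceFrame_scalars_of_nonsplit' L v w hw hv
  have hσw : ∀ z : LocalRing L v, conjLocal L (IsCMField.complexConj L) v z w = galAdicCompletionMap (L := L) (IsCMField.complexConj L) hw (z w) :=
    fun z => conjLocal_apply_eq_of_smul_eq (IsCMField.complexConj L) hc1 v w hw z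
  have hπw : Valued.v (π w) = Valued.v ϖw := by rw [hvπ, hϖ1]
  have hπ'w : Valued.v (π' w) = (Valued.v ϖw)⁻¹ := by
    have h := congrFun hππ w
    rw [Pi.mul_apply, Pi.one_apply] at h
    have hvv : Valued.v (π w) * Valued.v (π' w) = 1 := by rw [← map_mul, h, map_one]
    rw [← hπw]
    exact eq_inv_of_mul_eq_one_right hvv
  have hsep := (isRegularElt_fst_snd_of_isLocalGRegular L v γH hreg).1
  rw [isRegularElt_iff] at hsep
  have hEF := exists_eigenframe_cmDatum_local_of_isRoot_map_of_separable L v w hw γH.1 hα hsep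
  obtain ⟨P₂, u, hP₂, hu, hu0⟩ := hEF
  have hu1w : u 1 w = γ := by
    rcases eq_or_eq_eval_of_isRoot_of_eigenframe L v w hP₂ hγ with h | h
    · exact absurd (h.trans hu0) (Ne.symm hαγ)
    · exact h.symm
  have hu1 : ∀ i, conjLocal L (IsCMField.complexConj L) v (u i) * u i = 1 :=
    forall_conjLocal_mul_eq_one_of_not_exists_conj_glDiagonal L v w hw hP₂ hu hlev
  have hb1 := conjLocal_finGammaTwo_mul_finGammaTwo L v γH
  have hP₂' : (γH.1.val.val : Matrix (Fin 2) (Fin 2) (LocalRing L v)) * P₂.val = P₂.val * diagonal ![u 0, u 1] := by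
    rw [hP₂]; congr 1; ext i j; fin_cases i <;> fin_cases j <;> rfl
  have hαb : α ≠ finGammaTwo L v γH w := fun h0 => by
    rw [h0, sub_self, map_zero] at hN₁; exact WithZero.zero_ne_coe hN₁
  have hγb : γ ≠ finGammaTwo L v γH w := fun h0 => by
    rw [h0, sub_self, map_zero] at hN₂; exact WithZero.zero_ne_coe hN₂
  have had : u 0 ≠ u 1 := fun h => zero_ne_one (hu h)
  have hab : u 0 ≠ finGammaTwo L v γH := fun h => hαb (by rw [← hu0, h])
  have hbd : finGammaTwo L v γH ≠ u 1 := fun h => hγb (by rw [← hu1w, ← h])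
  -- deepness and the exponents, read on the eigenvalues `a = u 0`, `b = u`, `d = u 1`
  have hda : Valued.v (u 0 w - 1) < 1 := by rw [hu0]; exact hα1
  have hdd : Valued.v (u 1 w - 1) < 1 := by rw [hu1w]; exact hγ1
  have hvad : Valued.v (u 0 w - u 1 w) = WithZero.exp (-(N : ℤ)) := by rw [hu0, hu1w]; exact hN
  have hvda : Valued.v (u 1 w - u 0 w) = WithZero.exp (-(N : ℤ)) := by rw [Valuation.map_sub_swap, hvad]
  have hvab : Valued.v (u 0 w - finGammaTwo L v γH w) = WithZero.exp (-(N₁ : ℤ)) := by rw [hu0]; exact hN₁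
  have hvba : Valued.v (finGammaTwo L v γH w - u 0 w) = WithZero.exp (-(N₁ : ℤ)) := by rw [Valuation.map_sub_swap, hvab]
  have hvdb : Valued.v (u 1 w - finGammaTwo L v γH w) = WithZero.exp (-(N₂ : ℤ)) := by rw [hu1w]; exact hN₂
  have hvbd : Valued.v (finGammaTwo L v γH w - u 1 w) = WithZero.exp (-(N₂ : ℤ)) := by rw [Valuation.map_sub_swap, hvdb]
  -- the four matched TRACE representatives `t₁ … t₄` under ONE level-preserving congruence `ψ` (★ (P3c) `exists_four_matched_trace_representatives`)
  have hREP := exists_four_matched_trace_representatives L H' hH'c w hw hv hH'w hH'i (γH := γH) hb hσπ hππ hπN hε (hu1 0) (hu1 1) hP₂' had hab hbd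
  obtain ⟨Tl, ψ, t₁, t₂, t₃, t₄, τ₁, τ₂, τ₃, τ₄, P, Q, dπ, g₃, g₄, hform, hψ, -, hlevψ, hn₁, hn₂, hn₃, hn₄, hP, hu', hu'1, hPQ, hQ,
    hψ₁, hψ₂, hψ₃, hψ₄, hτ₁, hτ₂c, hτ₃c, hτ₄c, hdπ, hg₃, hg₄, hτ₂, hτ₃, hτ₄, n12, n34⟩ := hREP
  have hda3 : Valued.v (u 0 w - 1) < Valued.v (ϖw ^ 3) := by rw [hu0]; exact hα3
  have hdd3 : Valued.v (u 1 w - 1) < Valued.v (ϖw ^ 3) := by rw [hu1w]; exact hγ3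
  -- §5 THE SUPPORT IS THE FOUR MATCHED CLASSES (★ organ)
  have hα' : ((finCharpolyTwo L v γH).map (Pi.evalRingHom (fun w' : PlacesOver L v => w'.1.adicCompletion L) w)).IsRoot α := hα
  have hγ' : ((finCharpolyTwo L v γH).map (Pi.evalRingHom (fun w' : PlacesOver L v => w'.1.adicCompletion L) w)).IsRoot γ := hγ
  have hχu : IsUnit ((finCharpolyTwo L v γH).eval (finGammaTwo L v γH)) := isUnit_eval_finCharpolyTwo_of_isRoot L v w γH hvs hα' hγ' hαγ hαb hγb
  have hHf := map_conjLocal_transpose_localForm L 3 H' v hH'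
  have hHd := isUnit_det_localForm L 3 H' v (Matrix.isUnit_iff_isUnit_det _ |>.1 hH'u).ne_zero
  have himg : ∀ {t : (cmDatum L 3 H').Local v} {τ : ↥(UnitaryGroup.«local» L (IsCMField.complexConj L) 3
      (Matrix.of fun i j : Fin 3 => if i.val + j.val + 1 = 3 then (1 : L) else 0) v)}, ψ t = τ → Tl * t.val * Tl⁻¹ = τ.val := by
    intro t τ h
    rw [← hψ t, h]
  -- the signs `κ = (+,+,−,−)` in the trace frame (★ p851771; `hG₃ hG₄` from ★ `FlickerTraceFramePermutation`)
  obtain ⟨αg, hα0, hcα, -⟩ := cmQuadraticGenerator_spec L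
  have hσσ : ∀ x, conjLocal L (IsCMField.complexConj L) v (conjLocal L (IsCMField.complexConj L) v x) = x :=
    fun x => Liu2021.LemD1OfPlace.conjLocal_conjLocal_apply L v (IsCMField.complexConj L) hcα hα0 x
  have hG₃ : twistGram (conjLocal L (IsCMField.complexConj L) v) (Matrix.of fun i j : Fin 3 => if i.val + j.val + 1 = 3 then (1 : LocalRing L v) else 0) (g₃.val * Q.val) = !![π, 0, 0; 0, -π, 0; 0, 0, -1] := by
    rw [hg₃, hQ, gThreeTrace_mul_traceFrame _ hb, twistGram_traceFrameThree _ hσσ hb hσπ hε]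
  have hG₄ : twistGram (conjLocal L (IsCMField.complexConj L) v) (Matrix.of fun i j : Fin 3 => if i.val + j.val + 1 = 3 then (1 : LocalRing L v) else 0) (g₄.val * Q.val) = !![1, 0, 0; 0, π, 0; 0, 0, -π] := by
    rw [hg₄, hQ, gFourTrace_mul_traceFrame _ hb, twistGram_traceFrameFour _ hσσ hb hσπ]
  have hκ := finKappaAt_trace_representatives_eq L v H' γH w hw hχu hHf hHd hb hε hσπ hπN hform hn₁ hn₃ hn₄ hP hu' hu'1 hPQ hQ hdπ hG₃ hG₄
    (by rw [himg hψ₂, himg hψ₁, hτ₂c]) (by rw [himg hψ₃, himg hψ₁, hτ₃c]) (by rw [himg hψ₄, himg hψ₁, hτ₄c])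
  obtain ⟨hκ₁, hκ₂, hκ₃, hκ₄⟩ := hκ
  -- §6 THE TRANSPORT: `Tl_w⁻¹ = u · k` with `u ∈ U(H′_w)`, `k ∈ GL₃(𝒪_w)` (★ L1 at the inert place)
  set Tlw : GL (Fin 3) (w.1.adicCompletion L) := localGLPiEquiv L 3 v Tl w with hTlw
  set eH := localNonsplitEquiv (IsCMField.complexConj L) H' (IsCMField.complexConj_ne_one L) w hw with heH
  have hmapw : ∀ M : Matrix (Fin 3) (Fin 3) (LocalRing L v), (M.map (conjLocal L (IsCMField.complexConj L) v)).map
      (Pi.evalRingHom (fun w' : PlacesOver L v => w'.1.adicCompletion L) w) =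
      (M.map (Pi.evalRingHom (fun w' : PlacesOver L v => w'.1.adicCompletion L) w)).map
        (galAdicCompletionMap (L := L) (IsCMField.complexConj L) hw : w.1.adicCompletion L → w.1.adicCompletion L) := by
    intro M; exact Matrix.ext fun i j => by simp only [Matrix.map_apply]; exact hσw (M i j)
  have hTlw_val : ∀ X : GL (Fin 3) (LocalRing L v), ((localGLPiEquiv L 3 v X w : GL (Fin 3) (w.1.adicCompletion L)) :
      Matrix (Fin 3) (Fin 3) (w.1.adicCompletion L)) =
      (X : Matrix (Fin 3) (Fin 3) (LocalRing L v)).map (Pi.evalRingHom (fun w' : PlacesOver L v => w'.1.adicCompletion L) w) := by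
    intro X; exact Matrix.ext fun i j => by rw [localGLPiEquiv_apply_apply, Matrix.map_apply]; rfl
  have hTlw_inv : Tlw⁻¹ = localGLPiEquiv L 3 v Tl⁻¹ w := by rw [hTlw, map_inv, Pi.inv_apply]
  have hH'Loc : ((adelicForm L 3 H').map (adeleToLocal L v)).map (Pi.evalRingHom (fun w' : PlacesOver L v => w'.1.adicCompletion L) w) =
      placeForm H' w.1 := localForm_map_eval L 3 H' v w
  have hΦLoc : (Matrix.of fun i j : Fin 3 => if i.val + j.val + 1 = 3 then (1 : LocalRing L v) else 0).map
      (Pi.evalRingHom (fun w' : PlacesOver L v => w'.1.adicCompletion L) w) = (StdForm.antidiagonal 3).over (w.1.adicCompletion L) := by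
    rw [← antidiagOne_eq_over (w.1.adicCompletion L) 3]
    exact Matrix.ext fun i j => by simp only [Matrix.map_apply, Matrix.of_apply]; split_ifs <;> simp
  have hΦw : IsUnit (placeForm ((StdForm.antidiagonal 3).over L) w.1) := by
    rw [placeForm_antidiagonal]; exact StdForm.isUnit_over _ _
  -- `hform` read at `w`: `formCongr σ_w Tlw⁻¹ (H′_w) = Φ₃,w ∈ GL₃(𝒪_w)`
  have hgram : ∃ J' ∈ glInt 3 (w.1.adicCompletion L), (J' : Matrix (Fin 3) (Fin 3) (w.1.adicCompletion L)) =
      formCongr (galAdicCompletionMap (L := L) (IsCMField.complexConj L) hw) Tlw⁻¹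
        ((hH'w.unit : GL (Fin 3) (w.1.adicCompletion L)) : Matrix (Fin 3) (Fin 3) (w.1.adicCompletion L)) := by
    refine ⟨hΦw.unit, isUnit_placeForm_antidiagonal_unit_mem_glInt (E := L) (N := 3) w.1 hΦw, ?_⟩
    have hf : (Matrix.of fun i j : Fin 3 => if i.val + j.val + 1 = 3 then (1 : LocalRing L v) else 0) =
        formCongr (conjLocal L (IsCMField.complexConj L) v) Tl⁻¹ ((adelicForm L 3 H').map (adeleToLocal L v)) := by
      rw [← hform, formCongr_inv_formCongr]
    have hfw := congrArg (fun M : Matrix (Fin 3) (Fin 3) (LocalRing L v) =>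
      M.map (Pi.evalRingHom (fun w' : PlacesOver L v => w'.1.adicCompletion L) w)) hf
    simp only [formCongr, Matrix.map_mul, Matrix.transpose_map, hmapw, hH'Loc, hΦLoc, ← hTlw_val, ← hTlw_inv] at hfw
    rw [IsUnit.unit_spec, IsUnit.unit_spec, placeForm_antidiagonal, hfw]
  have hL1 := exists_mem_unitaryGroupOfForm_mul_of_selfDual_of_nonsplit (IsCMField.complexConj L) w hc1 hw hv hH'w.unit hH'i
    (placeForm_hermitian_of_smul_eq (IsCMField.complexConj L) w H' hH'c hw) Tlw⁻¹ hgram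
  obtain ⟨uu, huu, k, hk, huk⟩ := hL1
  have hTlw' : Tlw = k⁻¹ * uu⁻¹ := by rw [← _root_.mul_inv_rev, ← huk, inv_inv]
  have hpos2 : 0 < Valued.v (ϖw ^ 2) := by rw [map_pow, hϖ1]; exact pow_pos (zero_lt_iff.2 WithZero.exp_ne_zero) _
  -- §7 THE REPRESENTATIVE `γ₀ := s⁻¹ t s`, `s := e_H⁻¹(u)`: `e_H(γ₀) = k · (ψ t)_w · k⁻¹ ∈ GL₃(𝒪_w)`, `≡ 1 (mod ϖ_w²)` (lemma above)
  have main := fun (t : ↥(UnitaryGroup.«local» L (IsCMField.complexConj L) 3 H' v)) (M : Matrix (Fin 3) (Fin 3) (w.1.adicCompletion L))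
      (hM : ((((ψ t).val : GL (Fin 3) (LocalRing L v)) : Matrix (Fin 3) (Fin 3) (LocalRing L v)).map
        (Pi.evalRingHom (fun w' : PlacesOver L v => w'.1.adicCompletion L) w) = M))
      (hMD : ∀ a b, Valued.v ((M - 1) a b) ≤ Valued.v (ϖw ^ 2)) =>
    exists_conj_mem_localIntegralLevel_of_literal L H' w hw t Tl (ψ t) (hψ t) k uu hk huu (by rw [← huk, hTlw]) M hM (ϖw ^ 2) hpos2 (hϖpow 2) hMD
  -- §8 THE DEPTH OF THE TRACE LITERALS at `D = |ϖ_w|²` (★ (T6) for `τ₁`, ★ `valued_traceTorusEltPi_sub_one_le` for `τ₂ τ₃ τ₄`; eigenvalues 3-deep, `|π′_w| = |ϖ_w|⁻¹`; NO `|2|`)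
  have hpow32 : Valued.v (ϖw ^ 3) ≤ Valued.v (ϖw ^ 2) := by
    rw [map_pow, map_pow]; exact pow_le_pow_right_of_le_one' hϖlt.le (by norm_num)
  have hbw : b w + galAdicCompletionMap (L := L) (IsCMField.complexConj L) hw (b w) = 1 := by
    have h := congrFun hb w
    rw [Pi.add_apply, hσw, Pi.one_apply] at h
    exact h
  have hb1 : Valued.v (b w) ≤ 1 := hvb.le
  have hσb1 : Valued.v (galAdicCompletionMap (L := L) (IsCMField.complexConj L) hw (b w)) ≤ 1 := by rw [valued_galAdicCompletionMap]; exact hvb.le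
  have hoff : ∀ {x₁ x₃ : w.1.adicCompletion L}, Valued.v (x₁ - 1) < Valued.v (ϖw ^ 3) → Valued.v (x₃ - 1) < Valued.v (ϖw ^ 3) →
      Valued.v (π w * (x₁ - x₃)) ≤ Valued.v (ϖw ^ 2) ∧
        Valued.v (π' w * (x₁ - x₃)) ≤ Valued.v (ϖw ^ 2) := by
    intro x₁ x₃ h₁ h₃
    have hlt : Valued.v (x₁ - x₃) < Valued.v (ϖw ^ 3) :=
      lt_of_le_of_lt (by rw [show x₁ - x₃ = (x₁ - 1) - (x₃ - 1) by ring]; exact Valuation.map_sub _ _ _) (max_lt h₁ h₃)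
    refine ⟨?_, ?_⟩
    · rw [map_mul, hπw]
      exact ((mul_le_of_le_one_left zero_le hϖlt.le).trans hlt.le).trans hpow32
    · rw [map_mul, hπ'w]
      calc (Valued.v ϖw)⁻¹ * Valued.v (x₁ - x₃) ≤ (Valued.v ϖw)⁻¹ * Valued.v (ϖw ^ 3) := mul_le_mul' le_rfl hlt.le
        _ = Valued.v (ϖw ^ 2) := by rw [map_pow, map_pow, pow_succ, mul_comm, mul_inv_cancel_right₀ hϖ0]
  have hxa : Valued.v (u 0 w - 1) ≤ Valued.v (ϖw ^ 2) := hda3.le.trans hpow32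
  have hxd : Valued.v (u 1 w - 1) ≤ Valued.v (ϖw ^ 2) := hdd3.le.trans hpow32
  have hxb : Valued.v (finGammaTwo L v γH w - 1) ≤ Valued.v (ϖw ^ 2) := hub.le.trans hpow32
  obtain ⟨hπad, hπ'ad⟩ := hoff hda3 hdd3
  obtain ⟨hπab, hπ'ab⟩ := hoff hda3 hub
  obtain ⟨hπbd, hπ'bd⟩ := hoff hub hdd3
  have hM₁ : ((((ψ t₁).val : GL (Fin 3) (LocalRing L v)) : Matrix (Fin 3) (Fin 3) (LocalRing L v)).map
      (Pi.evalRingHom (fun w' : PlacesOver L v => w'.1.adicCompletion L) w)) =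
      !![u 0 w * galAdicCompletionMap (L := L) (IsCMField.complexConj L) hw (b w) + u 1 w * b w, 0, u 0 w - u 1 w; 0, finGammaTwo L v γH w, 0; b w * galAdicCompletionMap (L := L) (IsCMField.complexConj L) hw (b w) * (u 0 w - u 1 w), 0, u 0 w * b w + u 1 w * galAdicCompletionMap (L := L) (IsCMField.complexConj L) hw (b w)] := by
    rw [hψ₁, hτ₁, map_evalRingHom_traceTorusElt, hσw]
  have hM₂ : ((((ψ t₂).val : GL (Fin 3) (LocalRing L v)) : Matrix (Fin 3) (Fin 3) (LocalRing L v)).map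
      (Pi.evalRingHom (fun w' : PlacesOver L v => w'.1.adicCompletion L) w)) =
      !![u 0 w * galAdicCompletionMap (L := L) (IsCMField.complexConj L) hw (b w) + u 1 w * b w, 0, π w * (u 0 w - u 1 w); 0, finGammaTwo L v γH w, 0; π' w * (b w * galAdicCompletionMap (L := L) (IsCMField.complexConj L) hw (b w) * (u 0 w - u 1 w)), 0, u 0 w * b w + u 1 w * galAdicCompletionMap (L := L) (IsCMField.complexConj L) hw (b w)] := by
    rw [hψ₂, hτ₂, map_evalRingHom_traceTorusEltPi, hσw]
  have hM₃ : ((((ψ t₃).val : GL (Fin 3) (LocalRing L v)) : Matrix (Fin 3) (Fin 3) (LocalRing L v)).map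
      (Pi.evalRingHom (fun w' : PlacesOver L v => w'.1.adicCompletion L) w)) =
      !![u 0 w * galAdicCompletionMap (L := L) (IsCMField.complexConj L) hw (b w) + finGammaTwo L v γH w * b w, 0, π w * (u 0 w - finGammaTwo L v γH w); 0, u 1 w, 0; π' w * (b w * galAdicCompletionMap (L := L) (IsCMField.complexConj L) hw (b w) * (u 0 w - finGammaTwo L v γH w)), 0, u 0 w * b w + finGammaTwo L v γH w * galAdicCompletionMap (L := L) (IsCMField.complexConj L) hw (b w)] := by
    rw [hψ₃, hτ₃, map_evalRingHom_traceTorusEltPi, hσw]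
  have hM₄ : ((((ψ t₄).val : GL (Fin 3) (LocalRing L v)) : Matrix (Fin 3) (Fin 3) (LocalRing L v)).map
      (Pi.evalRingHom (fun w' : PlacesOver L v => w'.1.adicCompletion L) w)) =
      !![finGammaTwo L v γH w * galAdicCompletionMap (L := L) (IsCMField.complexConj L) hw (b w) + u 1 w * b w, 0, π w * (finGammaTwo L v γH w - u 1 w); 0, u 0 w, 0; π' w * (b w * galAdicCompletionMap (L := L) (IsCMField.complexConj L) hw (b w) * (finGammaTwo L v γH w - u 1 w)), 0, finGammaTwo L v γH w * b w + u 1 w * galAdicCompletionMap (L := L) (IsCMField.complexConj L) hw (b w)] := by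
    rw [hψ₄, hτ₄, map_evalRingHom_traceTorusEltPi, hσw]
  -- §9 CONCLUSION: support ⊆ four classes, each with a 2-deep `K`-representative
  intro cG hΔ _hmeet
  have hΔ' : finExplicitDelta L v H' γH μ (Quotient.out cG) ≠ 0 := hΔ
  have hsupp := mk_eq_or_of_finExplicitDelta_out_ne_zero L v H' γH w hw μ hn₁ hn₂ hn₃ hn₄ hHf hHd hP hu' hu'1 n12 n34 hκ₁ hκ₂ hκ₃ hκ₄ cG hΔ'
  rcases hsupp with hc | hc | hc | hc
  · have hm := main t₁ _ hM₁ (valued_traceTorusElt_sub_one_le (galAdicCompletionMap (L := L) (IsCMField.complexConj L) hw) hbw hb1 hσb1 hxa hxb hxd)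
    obtain ⟨γ₀, h1, hK, hdp⟩ := hm
    exact ⟨γ₀, h1.trans hc.symm, hK, hdp⟩
  · have hm := main t₂ _ hM₂ (valued_traceTorusEltPi_sub_one_le (galAdicCompletionMap (L := L) (IsCMField.complexConj L) hw) hbw hb1 hσb1 hxa hxb hxd hπad hπ'ad)
    obtain ⟨γ₀, h1, hK, hdp⟩ := hm
    exact ⟨γ₀, h1.trans hc.symm, hK, hdp⟩
  · have hm := main t₃ _ hM₃ (valued_traceTorusEltPi_sub_one_le (galAdicCompletionMap (L := L) (IsCMField.complexConj L) hw) hbw hb1 hσb1 hxa hxd hxb hπab hπ'ab)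
    obtain ⟨γ₀, h1, hK, hdp⟩ := hm
    exact ⟨γ₀, h1.trans hc.symm, hK, hdp⟩
  · have hm := main t₄ _ hM₄ (valued_traceTorusEltPi_sub_one_le (galAdicCompletionMap (L := L) (IsCMField.complexConj L) hw) hbw hb1 hσb1 hxb hxa hxd hπbd hπ'bd)
    obtain ⟨γ₀, h1, hK, hdp⟩ := hm
    exact ⟨γ₀, h1.trans hc.symm, hK, hdp⟩

end Literature.NumberTheory.Rogawski1990

end
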